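import Summits.FinalStateConjecture.FinalStateConjecture.Theorems.PhotonSphereChannelsTameCensorshipExactKerrRegion
import Literature.Geometry.Lorentzian.IsometricImmersionExp
import Literature.Geometry.Lorentzian.GeodesicProofs
import Literature.Geometry.Lorentzian.FutureNullCompleteness
import Literature.Geometry.Lorentzian.SecondFundamentalFormLift
import Literature.Geometry.Lorentzian.HypersurfaceRestriction
import Literature.Geometry.Lorentzian.KerrConvergence
import Literature.Geometry.Lorentzian.NullInfinity
import HarnessLib

/-!
# Crux `TameCensorship` (stmt-FinalStateConjecture-10047), line `crush-the-swallowed-interior`,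
# stub B `stub_exactKerrBookkeeping`: uniform tame charts at the visible points of the exact part
# (conjunct B4), from the Kerr facts read through an exact-Kerr chart

Tools for conjunct (B4) of stub B: a local isometric chart carries geodesics to geodesics
(`isGeodesicOn_comp_of_chart`, from the tree's `isGeodesicOn_restrict_iff` and
`IsIsometricImmersion.isGeodesicOn_comp`), and an affine frame `y ↦ x + A y` of the coordinate ball
`B(0, r')` inside an open set on which a Kerr–Schild chart map `χ'` is a smooth isometric open
embedding yields a late chart of the Minkowski background on the ball, centred at `χ' x`, whose
metric deviation is the Kerr–Schild expression `A^*g_{M,a}(x + A ·) − η`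
(`exists_lateChart_of_frame`).

References: O'Neill 1983, Ch. 3, pp. 90–91 (isometries and geodesics); Dafermos–Holzegel–
Rodnianski–Taylor arXiv:2104.08222, §1 (the metric deviation in a chart).
-/

set_option linter.dupNamespace false

noncomputable section

open scoped Manifold ContDiff Topology ENNReal NNReal
open Set Filter Bundle Function Topology
open Literature.Geometry.Lorentzian

namespace Summit.FinalStateConjecture.FinalStateConjecture.Theorems.PhotonSphereChannels.TameCensorshipCrush

universe u

/-! ## Geodesics through a local isometric chart -/

section Geodesic

variable {𝓢 𝓣 : Spacetime.{u} 4} {U : Set 𝓢.carrier} {χ : 𝓢.carrier → 𝓣.carrier}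

/-- **A local isometric chart carries geodesics to geodesics**: if `χ` is smooth on an open `U`
with `g_𝓣(dχ v, dχ w) = g_𝓢(v, w)` there, and `γ` is a geodesic of `g_𝓢` on an open parameter set
`s` with `γ(s) ⊆ U`, then `χ ∘ γ` is a geodesic of `g_𝓣` on `s` (read `γ` in the open
sub-manifold `U`, `isGeodesicOn_restrict_iff`, and apply `IsIsometricImmersion.isGeodesicOn_comp`
to the isometric immersion `χ|_U`). O'Neill 1983, Ch. 3, pp. 90–91.
[cite: ONeillSemiRiemannian1983, Ch. 3, pp. 90–91 and Prop. 3.59] -/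
theorem isGeodesicOn_comp_of_chart [𝓢.metric.HasLeviCivita] [𝓣.metric.HasLeviCivita]
    (hU : IsOpen U) (hχs : ContMDiffOn (𝓡 4) (𝓡 4) ∞ χ U)
    (hχ : ∀ p ∈ U, ∀ v w, 𝓣.metric.val (χ p) (mfderiv (𝓡 4) (𝓡 4) χ p v)
        (mfderiv (𝓡 4) (𝓡 4) χ p w) = 𝓢.metric.val p v w)
    {γ : ℝ → 𝓢.carrier} {s : Set ℝ} (hs : IsOpen s)
    (hγ : IsGeodesicOn 𝓢.metric.leviCivita γ s) (hγU : ∀ t ∈ s, γ t ∈ U) :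
    IsGeodesicOn 𝓣.metric.leviCivita (χ ∘ γ) s := by
  classical
  rcases s.eq_empty_or_nonempty with rfl | ⟨t₀, ht₀⟩
  · exact ⟨fun t ht ↦ ht.elim, fun t ht ↦ ht.elim⟩
  haveI : Fact ((1 : ℕ∞ω) ≤ ((⊤ : ℕ∞) : WithTop ℕ∞)) := ⟨by exact_mod_cast le_top⟩
  let O : TopologicalSpace.Opens 𝓢.carrier := ⟨U, hU⟩
  let gO := 𝓢.metric.toPseudoRiemannianMetric.restrict
    PseudoRiemannianMetric.contMDiff_restrict_holds O
  haveI : gO.HasLeviCivita := gO.hasLeviCivita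
  -- lift `γ` into the open sub-manifold `O`
  let γO : ℝ → O := fun t ↦ if h : γ t ∈ U then ⟨γ t, h⟩ else ⟨γ t₀, hγU t₀ ht₀⟩
  have hval : ∀ t ∈ s, ((γO t : O) : 𝓢.carrier) = γ t := fun t ht ↦ by
    simp only [γO, dif_pos (hγU t ht)]
  have h1 : IsGeodesicOn 𝓢.metric.leviCivita (Subtype.val ∘ γO) s :=
    IsGeodesicOn.congr_holds hγ hs (fun t ht ↦ (hval t ht).symm)
  have h2 : IsGeodesicOn gO.leviCivita γO s :=
    (PseudoRiemannianMetric.isGeodesicOn_restrict_iff _ O hs).2 h1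
  -- `χ ∘ ι` is an isometric immersion of `(O, g|_O)` into `𝓣`
  have hf : PseudoRiemannianMetric.IsIsometricImmersion gO 𝓣.metric.toPseudoRiemannianMetric
      (χ ∘ Subtype.val : O → 𝓣.carrier) := by
    refine ⟨hχs.comp_contMDiff contMDiff_subtype_val (fun y ↦ y.2), fun y ↦ ?_⟩
    have hd : MDifferentiableAt (𝓡 4) (𝓡 4) χ y.1 :=
      ((hχs _ y.2).contMDiffAt (hU.mem_nhds y.2)).mdifferentiableAt (by simp)
    ext v w
    rw [pullbackBilin_apply, mfderiv_comp_subtypeVal hd]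
    exact hχ _ y.2 v w
  have h3 := (hf.isGeodesicOn_comp rfl hs h2).1
  refine IsGeodesicOn.congr_holds h3 hs (fun t ht ↦ ?_)
  show χ ((γO t : O) : 𝓢.carrier) = χ (γ t)
  rw [hval t ht]

/-- **Such a chart preserves `g(γ', γ')`**: `g_𝓣((χ ∘ γ)', (χ ∘ γ)') = g_𝓢(γ', γ')` along a future
causal curve inside `U` (chain rule and the isometry clause). O'Neill 1983, Ch. 3, p. 58.
[cite: ONeillSemiRiemannian1983, Ch. 3, p. 58] -/
theorem val_velocity_comp_of_chart (hU : IsOpen U) (hχs : ContMDiffOn (𝓡 4) (𝓡 4) ∞ χ U)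
    (hχ : ∀ p ∈ U, (∀ v w, 𝓣.metric.val (χ p) (mfderiv (𝓡 4) (𝓡 4) χ p v)
        (mfderiv (𝓡 4) (𝓡 4) χ p w) = 𝓢.metric.val p v w) ∧
      𝓣.timeOrientation.IsFutureDirected
        (mfderiv (𝓡 4) (𝓡 4) χ p (𝓢.timeOrientation.vectorField p)))
    {γ : ℝ → 𝓢.carrier} {s : Set ℝ} (hγ : 𝓢.metric.IsFutureCausalCurveOn 𝓢.timeOrientation γ s)
    (hγU : ∀ t ∈ s, γ t ∈ U) {t : ℝ} (ht : t ∈ s) :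
    𝓣.metric.val ((χ ∘ γ) t) (velocity (𝓡 4) (χ ∘ γ) t) (velocity (𝓡 4) (χ ∘ γ) t) =
      𝓢.metric.val (γ t) (velocity (𝓡 4) γ t) (velocity (𝓡 4) γ t) := by
  obtain ⟨-, hvel⟩ := isFutureCausalCurveOn_comp_of_chart hU hχs hχ hγ hγU
  rw [hvel t ht]
  exact (hχ _ (hγU t ht)).1 _ _

/-- **Such a chart carries causal relations**: `χ (γ b) ∈ J⁺(χ (γ a))` for a future causal curve
`γ` on `[a, b]`, `a < b`, inside `U`. O'Neill 1983, Ch. 14, pp. 402–403.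
[cite: ONeillSemiRiemannian1983, Ch. 14, pp. 402–403] -/
theorem mem_causalFuture_comp_of_chart (hU : IsOpen U) (hχs : ContMDiffOn (𝓡 4) (𝓡 4) ∞ χ U)
    (hχ : ∀ p ∈ U, (∀ v w, 𝓣.metric.val (χ p) (mfderiv (𝓡 4) (𝓡 4) χ p v)
        (mfderiv (𝓡 4) (𝓡 4) χ p w) = 𝓢.metric.val p v w) ∧
      𝓣.timeOrientation.IsFutureDirected
        (mfderiv (𝓡 4) (𝓡 4) χ p (𝓢.timeOrientation.vectorField p)))
    {γ : ℝ → 𝓢.carrier} {a b : ℝ} (hab : a < b)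
    (hγ : 𝓢.metric.IsFutureCausalCurveOn 𝓢.timeOrientation γ (Icc a b))
    (hγU : ∀ t ∈ Icc a b, γ t ∈ U) :
    χ (γ b) ∈ 𝓣.metric.causalFuture 𝓣.timeOrientation {χ (γ a)} :=
  Or.inr ⟨χ (γ a), mem_singleton _, χ ∘ γ, a, b, hab,
    (isFutureCausalCurveOn_comp_of_chart hU hχs hχ hγ hγU).1, rfl, rfl⟩

/-- **Such a chart carries chronological relations**: `χ (γ b) ∈ I⁺(χ (γ a))` for a future
timelike curve `γ` on `[a, b]`, `a < b`, inside `U`. O'Neill 1983, Ch. 14, pp. 402–403.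
[cite: ONeillSemiRiemannian1983, Ch. 14, pp. 402–403] -/
theorem mem_chronologicalFuture_comp_of_chart (hU : IsOpen U)
    (hχs : ContMDiffOn (𝓡 4) (𝓡 4) ∞ χ U)
    (hχ : ∀ p ∈ U, (∀ v w, 𝓣.metric.val (χ p) (mfderiv (𝓡 4) (𝓡 4) χ p v)
        (mfderiv (𝓡 4) (𝓡 4) χ p w) = 𝓢.metric.val p v w) ∧
      𝓣.timeOrientation.IsFutureDirected
        (mfderiv (𝓡 4) (𝓡 4) χ p (𝓢.timeOrientation.vectorField p)))
    {γ : ℝ → 𝓢.carrier} {a b : ℝ} (hab : a < b)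
    (hγ : 𝓢.metric.IsFutureTimelikeCurveOn 𝓢.timeOrientation γ (Icc a b))
    (hγU : ∀ t ∈ Icc a b, γ t ∈ U) :
    χ (γ b) ∈ 𝓣.metric.chronologicalFuture 𝓣.timeOrientation {χ (γ a)} :=
  ⟨χ (γ a), mem_singleton _, χ ∘ γ, a, b, hab,
    isFutureTimelikeCurveOn_comp_of_chart hU hχs hχ hγ hγU, rfl, rfl⟩

end Geodesic

/-! ## Late charts of the Minkowski background from an affine frame in a Kerr–Schild chart -/

section Frame

/-- **A coordinate ball framed into an isometric Kerr–Schild chart is a late chart centred at the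
frame's origin, with the Kerr–Schild deviation.** Let `χ' : Kerr.region a r₁ → 𝓢` be smooth on an
open set `C`, an open embedding there, with `g(dχ' v, dχ' w) = g_{M,a}(v, w)` on `C`, and let
`y ↦ x + A y` (`A ∈ GL(ℝ⁴)`) carry the ball `B(0, r')` into `C`. Then
`Φ = χ' ∘ (x + A ·) : B(0, r') → 𝓢` is a late chart of the Minkowski background on the ball (from
time `−r'`, region `univ`), `Φ(0) = χ'(x + A 0)`, and its deviation extended by zero is
`y ↦ A^* g_{M,a}(x + A y) − η` extended by zero. DHRT arXiv:2104.08222, §1 (the deviation of a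
pulled-back metric); O'Neill 1983, Ch. 3, p. 58. [cite: arXiv210408222, §1] -/
theorem exists_lateChart_of_frame [Kerr.Facts] (𝓢 : Spacetime.{0} 4) {M a r₁ r' : ℝ}
    {C : Set (Kerr.region a r₁)} (hC : IsOpen C)
    {χ' : Kerr.region a r₁ → 𝓢.carrier}
    (hχ's : ContMDiffOn 𝓘(ℝ, E4) (𝓡 4) ((⊤ : ℕ∞) : WithTop ℕ∞) χ' C)
    (hχ'o : IsOpenEmbedding (C.restrict χ'))
    (hχ'g : ∀ z ∈ C, ∀ v w : E4, 𝓢.metric.val (χ' z) (mfderiv 𝓘(ℝ, E4) (𝓡 4) χ' z v)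
        (mfderiv 𝓘(ℝ, E4) (𝓡 4) χ' z w) = Kerr.bilin M a (z : E4) v w)
    (x : E4) (A : E4 ≃L[ℝ] E4)
    (hA : ∀ y ∈ Metric.ball (0 : E4) r', max r₁ 0 < Kerr.radius a (x + A y))
    (hAC : ∀ y (hy : y ∈ Metric.ball (0 : E4) r'),
      (⟨x + A y, Kerr.mem_region.2 (hA y hy)⟩ : Kerr.region a r₁) ∈ C) :
    ∃ Φ : (⟨Metric.ball (0 : E4) r', Metric.isOpen_ball⟩ : TopologicalSpace.Opens E4) → 𝓢.carrier,
      𝓢.IsLateChart (Minkowski.backgroundOn ⟨Metric.ball (0 : E4) r', Metric.isOpen_ball⟩)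
        Set.univ (-r') Φ ∧
      (∀ y : (⟨Metric.ball (0 : E4) r', Metric.isOpen_ball⟩ : TopologicalSpace.Opens E4),
        Φ y = χ' ⟨x + A (y : E4), Kerr.mem_region.2 (hA y y.2)⟩) ∧
      𝓢.deviationExtend (Minkowski.backgroundOn ⟨Metric.ball (0 : E4) r', Metric.isOpen_ball⟩) Φ =
        Function.extend
          (Subtype.val : (⟨Metric.ball (0 : E4) r', Metric.isOpen_ball⟩ :
            TopologicalSpace.Opens E4) → E4)
          (fun y ↦ (Kerr.bilin M a (x + A (y : E4))).bilinearComp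
            (A : E4 →L[ℝ] E4) (A : E4 →L[ℝ] E4) - Minkowski.bilin) 0 := by
  set U : TopologicalSpace.Opens E4 := ⟨Metric.ball (0 : E4) r', Metric.isOpen_ball⟩ with hU_def
  -- the affine frame, as a map into the Kerr–Schild chart
  let α : U → Kerr.region a r₁ := fun y ↦ ⟨x + A (y : E4), Kerr.mem_region.2 (hA y y.2)⟩
  have hαC : ∀ y, α y ∈ C := fun y ↦ hAC y y.2
  have haff : ContDiff ℝ ((⊤ : ℕ∞) : WithTop ℕ∞) (fun e : E4 ↦ x + A e) :=
    contDiff_const.add (A : E4 →L[ℝ] E4).contDiff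
  have hαv : (Subtype.val ∘ α) = (fun e : E4 ↦ x + A e) ∘ (Subtype.val : U → E4) := rfl
  have hαs : ContMDiff 𝓘(ℝ, E4) 𝓘(ℝ, E4) ∞ α := by
    rw [← ContMDiff.subtypeVal_comp_iff, hαv]
    exact haff.contMDiff.comp contMDiff_subtype_val
  have hdα : ∀ (y : U) (v : E4), mfderiv 𝓘(ℝ, E4) 𝓘(ℝ, E4) α y v = A v := by
    intro y v
    have hd : MDifferentiableAt 𝓘(ℝ, E4) 𝓘(ℝ, E4) (fun e : E4 ↦ x + A e) (y : E4) :=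
      haff.contMDiff.mdifferentiableAt (by simp)
    rw [← OpensChart.mfderiv_subtypeVal_comp ((hαs y).mdifferentiableAt (by simp)), hαv,
      mfderiv_comp_subtypeVal hd, mfderiv_eq_fderiv]
    exact congrArg (fun f : E4 →L[ℝ] E4 ↦ f v)
      (((A : E4 →L[ℝ] E4).hasFDerivAt.const_add x).fderiv)
  -- the chart
  let Φ : U → 𝓢.carrier := χ' ∘ α
  have hχ'd : ∀ y : U, MDifferentiableAt 𝓘(ℝ, E4) (𝓡 4) χ' (α y) := fun y ↦
    ((hχ's _ (hαC y)).contMDiffAt (hC.mem_nhds (hαC y))).mdifferentiableAt (by simp)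
  have hΦs : ContMDiff 𝓘(ℝ, E4) (𝓡 4) ∞ Φ := hχ's.comp_contMDiff hαs hαC
  have hdΦ : ∀ (y : U) (v : E4), mfderiv 𝓘(ℝ, E4) (𝓡 4) Φ y v =
      mfderiv 𝓘(ℝ, E4) (𝓡 4) χ' (α y) (A v) := by
    intro y v
    show mfderiv 𝓘(ℝ, E4) (𝓡 4) (χ' ∘ α) y v = _
    rw [mfderiv_comp y (hχ'd y) ((hαs y).mdifferentiableAt (by simp))]
    show mfderiv 𝓘(ℝ, E4) (𝓡 4) χ' (α y) (mfderiv 𝓘(ℝ, E4) 𝓘(ℝ, E4) α y v) = _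
    rw [hdα]
  -- the deviation
  have hdev : ∀ y : U, 𝓢.deviation (Minkowski.backgroundOn U) Φ y =
      (Kerr.bilin M a (x + A (y : E4))).bilinearComp (A : E4 →L[ℝ] E4) (A : E4 →L[ℝ] E4) -
        Minkowski.bilin := by
    intro y
    ext v w
    rw [Spacetime.deviation_apply]
    show 𝓢.metric.val (Φ y) (mfderiv 𝓘(ℝ, E4) (𝓡 4) Φ y v) (mfderiv 𝓘(ℝ, E4) (𝓡 4) Φ y w) -
      Minkowski.bilin v w = _
    rw [hdΦ, hdΦ, sub_apply, sub_apply, ContinuousLinearMap.bilinearComp_apply]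
    show 𝓢.metric.val (χ' (α y)) _ _ - Minkowski.bilin v w = _
    rw [hχ'g _ (hαC y)]
    rfl
  refine ⟨Φ, ⟨hΦs, ?_, Set.subset_univ _⟩, fun y ↦ rfl, ?_⟩
  · -- open embedding of the restriction to the late region `{-r' < y⁰}` (all of the ball)
    set L : Set U := (Minkowski.backgroundOn U).lateRegion (-r') with hL_def
    have hLo : IsOpen L := by
      have h0 : Continuous fun y : U ↦ (y : E4) 0 :=
        (PiLp.continuous_apply 2 _ 0).comp continuous_subtype_val
      exact isOpen_lt continuous_const h0
    -- `α` as an open embedding into `C`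
    have haffE : IsOpenEmbedding (fun e : E4 ↦ x + A e) := by
      have hfun : (fun e : E4 ↦ x + A e) =
          ⇑((A : E4 ≃L[ℝ] E4).toHomeomorph.trans (Homeomorph.addLeft x)) := funext fun e ↦ rfl
      rw [hfun]
      exact ((A : E4 ≃L[ℝ] E4).toHomeomorph.trans (Homeomorph.addLeft x)).isOpenEmbedding
    have hαE : IsOpenEmbedding α := by
      refine IsOpenEmbedding.of_comp α (Kerr.region a r₁).2.isOpenEmbedding_subtypeVal ?_
      show IsOpenEmbedding ((fun e : E4 ↦ x + A e) ∘ (Subtype.val : U → E4))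
      exact haffE.comp U.2.isOpenEmbedding_subtypeVal
    let αC : U → C := fun y ↦ ⟨α y, hαC y⟩
    have hαCE : IsOpenEmbedding αC :=
      IsOpenEmbedding.of_comp αC hC.isOpenEmbedding_subtypeVal hαE
    exact (hχ'o.comp (hαCE.comp hLo.isOpenEmbedding_subtypeVal) :
      IsOpenEmbedding ((C.restrict χ') ∘ αC ∘ (Subtype.val : L → U)))
  · -- the extended deviation
    unfold Spacetime.deviationExtend
    exact congrArg (fun f ↦ Function.extend Subtype.val f (0 : E4 → E4 →L[ℝ] E4 →L[ℝ] ℝ))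
      (funext hdev)

end Frame

end Summit.FinalStateConjecture.FinalStateConjecture.Theorems.PhotonSphereChannels.TameCensorshipCrush

end
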